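/-
Copyright (c) 2026 the pub-hodgecm-mathlib formalisation cell (harness21).  Prover seat hodgecm-mathlib-LH4-p09 (g8), req620 Track A «(D-RAM) FOUR-FRAME» squad
(heir dealer LH4-plan (g13) WORD #74 (2) ∕ #83: (d) cells, PART 3b — the G3 cell, WIDE fence).  2026-09-04.
-/
import Summits.HodgeConjecture.HodgeConjecture.Theorems.F0P3cDyRamLevLabelledCellsGlued                 -- ★ p860206 (this seat) PART 2: `cell_G1`'s currency; brings T1, T2b∕T2c, T3, K4∕K5, the G1 empties
import Summits.HodgeConjecture.HodgeConjecture.Theorems.F0P3cDyRamLevLabelledRotTokens                   -- (this seat) PART 3a: the rotated tokens' data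
import Summits.HodgeConjecture.HodgeConjecture.Theorems.F0P3cDyRamLabelledKappaGluedSocketsNotCut        -- ★ p859941 (LH4-p12 (g7)): `latticeInLevel_diagonal_latt_G1_iff_of_not_cut`, `…_G1_sep_latticeInLevel_of_not_cut`
import HarnessLib

/-!
# (D-RAM) four-frame, STAGE 1b — (d) CELLS, PART 3b: the GLUED cell `G3(ρ,s) = (2ρ+s, 2ρ+s, 2ρ)` of the two-token labelled κ-table at the letters of record,
# IN THE CURRENCY OF F0P3a-p01 (g36)'s `LevLabelledBoxSumWide (ℓ₁ ℓ₂)` (★ p860066 ∕ ED. 2: binder `hG3` token for token), ON THE WIDE FENCE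

Helper brick for dealer LH4-plan (g13) WORD #74 (2) ∕ #83 ((d) = the CELLS, this seat; the trunk∕law assembly is LH4-p12 (g7)'s `…LevLabelledTrunkOfBoxSum`): `Theorems/` only,
statement-first, ★-only imports, lane `--supports stmt-HodgeConjecture-24833 --as helper`; PAYS NO tier-0 row (count-neutral).
FENCE OF THIS FILE (what the assembler has at every row of record): `2 ≤ d`, `2d ≤ nᵢ + 1`, `ℓ₁ ≤ 2`, the WIDE `ℓ₂ ≤ nᵢ + ℓ₁` (★ `LevLabelledBoxSumWide`'s `hℓ₂`) and the
PARITY-ROUNDED `ℓ₂ ≤ nᵢ + nᵢ % 2` (at odd `d` the lo∕hi rows have `ℓ₂ = m* = 2d = nᵢ + 1` only over odd `nᵢ`; at even `d` and at the clean rows `ℓ₂ ≤ nᵢ`).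
THE POINT.  Through ★ T3 `…_G3_sep_two_of_G1` the G3 cell is a G1 cell of the rotated datum `(a, b; n₃, n₂, n₁)` with the ROTATED tokens of PART 3a; this file shows case by
case that it equals PART 2 `cell_G1`'s formula on the rotated datum (F0P3a-p01's SPEC §1): in the tube `E₂` is never cut and its read is TRUE; on the glue foot the read is
`[ℓ₂ + 2ρ ≤ 2n₂′]` when `E₂` is not cut, and when it IS cut both tokens are genuine with witness balls at distance `|g|·|1−g| = |ϖ|^s` exceeding both radii — EMPTY.
* §2 `finsum_stratum_G1_sep_and_eq_of_not_cut_right` (two-token twin of ★ p859941's socket reduction), **`cell_G1_rot`** (G1 cell of `(a,b)` with `(E₁,E₂)` = `cell_G1`'s RHS).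
* §3 **`cell_G3`** = `hG3` with `εG 2 := (ω(f₂), ω·ω(f₂)ω(1+f₂), ω·ω(1+f₂))`, `f₂` the trunk's third glue witness (★ p859769 §3 binder `hf₂` verbatim).

HONEST LABEL: helper cells for HYPOTHESES (the four lev trunk letters `hTrunkLo∕Hi∕CLo∕CHi` of ★ p859769 ∕ ★ p859848); STAGE-1b tier-0 rows and the ED. 5∕6 law stubs stay
OPEN; HC_CM is proved only modulo the 7 printed citations (2 remaining named inputs: hLiu418 = `stmt-HodgeConjecture-24832`, h413 = `stmt-HodgeConjecture-24833`) until rung 0 closes.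

## References
* [Kottwitz1986BaseChangeUnits] R. E. Kottwitz, *Base change for unit elements of Hecke algebras*, Compositio Math. 60 (1986), §1 pp. 240–241 (κ-orbital integrals of units as signed lattice counts).
* [LanglandsShelstad1987] R. P. Langlands, D. Shelstad, *On the definition of transfer factors*, Math. Ann. 278 (1987), §3 (κ as a character).
* [Rogawski1990] J. D. Rogawski, *Automorphic Representations of Unitary Groups in Three Variables*, Ann. of Math. Stud. 123 (1990), §4.9 Prop. 4.9.1 (a)(b) p. 55.
* [Serre1979] J.-P. Serre, *Local Fields*, GTM 67 (1979), Ch. V §3 Prop. 5, Cor. 3 (norm residue symbol; glue-unit rationality depth).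
-/

set_option autoImplicit false

noncomputable section

namespace Summit.HodgeConjecture.HodgeConjecture.Cruxes.H413.F0P3cDyRamLevLabelledCellsGluedThree

open Matrix WithZero
open Literature.NumberTheory.Automorphic Literature.NumberTheory.Automorphic.HermitianLattice Literature.NumberTheory.Automorphic.UnitaryGroup
open Literature.NumberTheory.Automorphic.UnitaryLatticeTree Literature.NumberTheory.Automorphic.UnitaryThreeFourFrame
open Literature.NumberTheory.LocalFields.WildQuadraticDatum
open Summit.HodgeConjecture.HodgeConjecture.Cruxes.H413.F0P3cDyRamDiagonalTorusDefs
open Summit.HodgeConjecture.HodgeConjecture.Cruxes.H413.F0P3cDyRamDiagonalStrataDefs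
open Summit.HodgeConjecture.HodgeConjecture.Cruxes.H413.F0P3cDyRamDiagonalKappaCountDefs
open Summit.HodgeConjecture.HodgeConjecture.Cruxes.H413.F0P3cDyRamDiagonalGluedStabiliserIndex (ne_zero_and_v_lt_one_of_v_eq_exp)
open Summit.HodgeConjecture.HodgeConjecture.Cruxes.H413.F0P3cDyRamDiagonalGluedStratum (stratum_G1_eq)
open Summit.HodgeConjecture.HodgeConjecture.Cruxes.H413.F0P3cDyRamElementDatumParity (isoceles_of_isElementDatum)
open Summit.HodgeConjecture.HodgeConjecture.Cruxes.H413.F0P3cDyRamGlueUnitRationalityDepth (exists_fixed_v_add_glueUnit_le_iff)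
open Summit.HodgeConjecture.HodgeConjecture.Cruxes.H413.F0P3cDyRamFourFrameCensusDefs
open Summit.HodgeConjecture.HodgeConjecture.Cruxes.H413.F0P3cDyRamLabelledSplitStrata (finsum_mem_sep_eq_ite_of_forall_iff)
open Summit.HodgeConjecture.HodgeConjecture.Cruxes.H413.F0P3cDyRamLabelledGluedLocusCensusFoot (v_glueUnit_eq)
open Summit.HodgeConjecture.HodgeConjecture.Cruxes.H413.F0P3cDyRamLabelledKappaGluedLocus
open Summit.HodgeConjecture.HodgeConjecture.Cruxes.H413.F0P3cDyRamLabelledKappaGluedLocusFoot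
open Summit.HodgeConjecture.HodgeConjecture.Cruxes.H413.F0P3cDyRamLabelledTwoTokenReductions
open Summit.HodgeConjecture.HodgeConjecture.Cruxes.H413.F0P3cDyRamLabelledKappaTwoTokenRotations
open Summit.HodgeConjecture.HodgeConjecture.Cruxes.H413.F0P3cDyRamLabelledKappaGluedSocketsNotCut (latticeInLevel_diagonal_latt_G1_iff_of_not_cut finsum_kappaCount_mul_stabiliserWeight_stratum_G1_sep_latticeInLevel_of_not_cut)
open Summit.HodgeConjecture.HodgeConjecture.Cruxes.H413.F0P3cDyRamLevLabelledCellsGlued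
open Summit.HodgeConjecture.HodgeConjecture.Cruxes.H413.F0P3cDyRamLevLabelledRotTokens
open scoped Valued WithZero Matrix MatrixGroups

/-! ## §2  The G1 cell of the rotated datum with the rotated tokens -/

section Rot

variable {K : Type} [Field K] [Valued K ℤᵐ⁰] [CompleteSpace K] [Fintype 𝓀[K]] {σ : K →+* K} {ϖ : K} {d t : ℕ} {a b : K} {N₀ n₁ n₂ n₃ : ℕ}
  {T : GL (Fin 3) K}

omit [CompleteSpace K] [Fintype 𝓀[K]] in
open Classical in
/-- **TWO-TOKEN G1 CELL, SECOND TOKEN NOT CUT** (two-token twin of ★ p859941's socket reduction): `Σᶠ_{G1, L₁ ∧ L₂} w = [reads₂] · Σᶠ_{G1, L₁} w` whenever the second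
token is not a genuine on-locus cut. [cite: Kottwitz1986BaseChangeUnits, §1 pp. 240–241] -/
theorem finsum_stratum_G1_sep_and_eq_of_not_cut_right (hD : IsRamifiedQuadraticDatum σ ϖ d t) (T : GL (Fin 3) K) (ρ s : ℕ) (hρ : 1 ≤ ρ) (hs : 1 ≤ s)
    (ℓ₁ : ℕ) (e₁ : Fin 3 → K) (ℓ₂ : ℕ) (e₂ : Fin 3 → K)
    (hcut₂ : ¬ (Valued.v (e₂ 2 - e₂ 1) = Valued.v (e₂ 2 - e₂ 0) * Valued.v ϖ ^ s ∧ Valued.v ϖ ^ (ℓ₂ + 2 * ρ + s) < Valued.v (e₂ 2 - e₂ 1)))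
    (w : Submodule 𝒪[K] (Fin 3 → K) → ℚ) :
    ∑ᶠ M ∈ {M | M ∈ stratum σ ϖ T ![2 * ρ, 2 * ρ + s, 2 * ρ + s] ∧ (LatticeInLevel ϖ ℓ₁ (Matrix.diagonal e₁) M ∧ LatticeInLevel ϖ ℓ₂ (Matrix.diagonal e₂) M)}, w M =
      if ((Valued.v (e₂ 0) ≤ Valued.v ϖ ^ ℓ₂ ∧ Valued.v (e₂ 1) ≤ Valued.v ϖ ^ ℓ₂ ∧ Valued.v (e₂ 2) ≤ Valued.v ϖ ^ ℓ₂) ∧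
          Valued.v (e₂ 1 - e₂ 0) ≤ Valued.v ϖ ^ (ℓ₂ + ρ) ∧ Valued.v (e₂ 2 - e₂ 1) ≤ Valued.v ϖ ^ (ℓ₂ + ρ + s) ∧
            (Valued.v (e₂ 2 - e₂ 1) ≤ Valued.v ϖ ^ (ℓ₂ + 2 * ρ + s) ∧ Valued.v (e₂ 2 - e₂ 0) * Valued.v ϖ ^ s ≤ Valued.v ϖ ^ (ℓ₂ + 2 * ρ + s))) then
        ∑ᶠ M ∈ {M | M ∈ stratum σ ϖ T ![2 * ρ, 2 * ρ + s, 2 * ρ + s] ∧ LatticeInLevel ϖ ℓ₁ (Matrix.diagonal e₁) M}, w M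
      else 0 := by
  have hvσ : ∀ c, Valued.v (σ c) = Valued.v c := hD.2.1
  have hϖ : Valued.v ϖ = exp (-1 : ℤ) := hD.2.2.1
  have hfix : ∀ x : K, σ x = x → x ≠ 0 → ∃ n : ℤ, Valued.v x = exp (2 * n) := hD.2.2.2.1
  have hϖ0 : ϖ ≠ 0 := (ne_zero_and_v_lt_one_of_v_eq_exp hϖ).1
  exact finsum_sep_and_eq_ite_of_forall_iff_right _ _ _ _ (fun M hM => by
    rw [stratum_G1_eq hvσ hfix hϖ T hρ hs] at hM
    obtain ⟨x, ζ, y'', hx, hζ, hy, rfl, -, -⟩ := hM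
    exact latticeInLevel_diagonal_latt_G1_iff_of_not_cut hϖ0 ℓ₂ ρ s e₂ hx hζ hy hcut₂) w

open Classical in
/-- **THE G1 CELL OF `(a, b; n₁, n₂, n₃)` WITH THE ROTATED TOKENS `E₁ = (0, x, y)`, `E₂ = (0, x², y²)` IN BOX-SUM CURRENCY** (`x = u(b−a)`, `y = u(1−a)`, `|u| = 1`;
fence `2 ≤ d`, `2d ≤ nᵢ + 1`, `ℓ₁ ≤ 2`, `ℓ₂ ≤ nᵢ`; `f₀` a deepest glue witness of `(a,b)`): the value is PART 2 `cell_G1`'s right-hand side VERBATIM.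
[cite: Kottwitz1986BaseChangeUnits, §1 pp. 240–241] [cite: LanglandsShelstad1987, §3] [cite: Serre1979, Ch. V §3 Prop. 5, Cor. 3] [cite: Rogawski1990, §4.9 Prop. 4.9.1 (a)(b) p. 55] -/
theorem cell_G1_rot (hD : IsRamifiedQuadraticDatum σ ϖ d t) (h2 : Valued.v (2 : K) < 1) (hE : IsElementDatum σ ϖ N₀ a b n₁ n₂ n₃) (hN₀ : d ≤ N₀)
    (hT : (T : Matrix (Fin 3) (Fin 3) K) = Matrix.diagonal ![a, b, 1]) (hd2 : 2 ≤ d) (hfence : 2 * d ≤ n₁ + 1 ∧ 2 * d ≤ n₂ + 1 ∧ 2 * d ≤ n₃ + 1)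
    {ℓ₁ ℓ₂ : ℕ} (hℓ₁ : ℓ₁ ≤ 2) (hℓ₂ : ℓ₂ ≤ n₁ + ℓ₁ ∧ ℓ₂ ≤ n₂ + ℓ₁ ∧ ℓ₂ ≤ n₃ + ℓ₁)
    (hℓ₂e : ℓ₂ ≤ n₁ + n₁ % 2 ∧ ℓ₂ ≤ n₂ + n₂ % 2 ∧ ℓ₂ ≤ n₃ + n₃ % 2) (ρ s : ℕ) (hρ : 1 ≤ ρ) (hs : 1 ≤ s) (i : Fin 3) {u : K} (hu : Valued.v u = 1)
    (f₀ : K) (hσf₀ : σ f₀ = f₀) (hf₀ : n₂ = n₃ → n₂ ≤ n₁ → Valued.v (f₀ + (b - 1) / (a - 1)) ≤ Valued.v ϖ ^ (n₁ - d + 1)) :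
    ∑ᶠ M ∈ {M | M ∈ stratum σ ϖ T ![2 * ρ, 2 * ρ + s, 2 * ρ + s] ∧
        (LatticeInLevel ϖ ℓ₁ (Matrix.diagonal ![0, u * (b - a), u * (1 - a)]) M ∧
          LatticeInLevel ϖ ℓ₂ (Matrix.diagonal ![0, (u * (b - a)) * (u * (b - a)), (u * (1 - a)) * (u * (1 - a))]) M)},
        (kappaCount σ ϖ 0 i M : ℚ) * stabiliserWeight σ M =
      (if 2 ∣ s ∧ 2 * ρ ≤ min n₂ n₃ ∧ 2 * ρ + s ≤ n₁ ∧ 2 * ρ + ℓ₁ ≤ n₂ ∧ 2 * ρ + s + ℓ₁ ≤ n₁ ∧ 2 * ρ + ℓ₂ ≤ 2 * n₂ then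
          (![(normSign σ (-1 : K) : ℚ) * (Fintype.card 𝓀[K] : ℚ) ^ (2 * ρ + s / 2 - 1) *
              ((if 2 * d ≤ s then (Fintype.card 𝓀[K] : ℚ) - 1 else 0) - (if s + 2 = 2 * d then 1 else 0)), 0, 0] : Fin 3 → ℚ) i
        else 0) +
      (if 2 ∣ s ∧ n₂ = n₃ ∧ n₁ = n₂ + s ∧ n₂ < 2 * ρ + ℓ₁ ∧ ℓ₁ + ρ ≤ n₂ ∧ ℓ₁ + 2 * ρ - n₂ ≤ n₂ - d + 1 ∧ 2 * ρ + ℓ₂ ≤ 2 * n₂ then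
          (![if 2 * d ≤ s + (ℓ₁ + 2 * ρ - n₂ + 1) then (normSign σ (-1 : K) : ℚ) * normSign σ (1 + f₀) else 0,
             if 2 * d ≤ ℓ₁ + 2 * ρ - n₂ + 1 then (normSign σ (-1 : K) : ℚ) * normSign σ f₀ * normSign σ (1 + f₀) else 0,
             if 2 * d ≤ ℓ₁ + 2 * ρ - n₂ + 1 then (normSign σ f₀ : ℚ) else 0] : Fin 3 → ℚ) i *
            (Fintype.card 𝓀[K] : ℚ) ^ (2 * ρ + s / 2 - (ℓ₁ + 2 * ρ - n₂ + 1) / 2)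
        else 0) := by
  classical
  obtain ⟨hσ, hvσ, hϖ, hfix, hd, hd1, -⟩ := id hD
  obtain ⟨han, hbn, -, ha1, hb1, h₁, h₂, h₃, -, hN2, hN3⟩ := id hE
  obtain ⟨hϖ0, hϖ1⟩ := ne_zero_and_v_lt_one_of_v_eq_exp hϖ
  have hvϖ0 : Valued.v ϖ ≠ 0 := (Valuation.ne_zero_iff _).2 hϖ0
  have hvϖ : 0 < Valued.v ϖ := (Valuation.pos_iff _).2 hϖ0
  have hu0 : u ≠ 0 := fun h => by rw [h, map_zero] at hu; exact zero_ne_one hu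
  have hple : ∀ m n : ℕ, Valued.v ϖ ^ m ≤ Valued.v ϖ ^ n ↔ n ≤ m := fun m n => UnitaryLatticeTree.v_pow_le_v_pow_iff hϖ m n
  have hpeq : ∀ m n : ℕ, Valued.v ϖ ^ m = Valued.v ϖ ^ n ↔ m = n := fun m n =>
    ⟨fun h => le_antisymm ((hple n m).1 h.ge) ((hple m n).1 h.le), fun h => by rw [h]⟩
  obtain ⟨hk₁, hd₁, h10₁, ⟨he₁0, he₁1, he₁2⟩, hk₂, h10₂, ⟨he₂0, he₂1, he₂2⟩, hd₂le⟩ := rotTokens_data hϖ1.le hu h₁ h₂ h₃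
  have hg₁ := glueRatio_rotToken₁_eq (b := b) hu0 ha1
  have hg₂ := glueRatio_rotToken₂_eq (b := b) hu0 ha1
  set E₁ : Fin 3 → K := ![0, u * (b - a), u * (1 - a)] with hE₁def
  set E₂ : Fin 3 → K := ![0, (u * (b - a)) * (u * (b - a)), (u * (1 - a)) * (u * (1 - a))] with hE₂def
  obtain ⟨hmin, -, -⟩ := isoceles_depths hϖ h₁ h₂ h₃
  -- odd `s`: empty
  by_cases hs2 : 2 ∣ s
  swap
  · rw [finsum_stratum_G1_sep_eq_zero_of_odd' hD T ρ s hρ hs2, if_neg (fun h => hs2 h.1), if_neg (fun h => hs2 h.1), add_zero]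
  obtain ⟨t', rfl⟩ := hs2
  have ht' : 1 ≤ t' := by omega
  have hdvd : (2 ∣ 2 * t') := ⟨t', rfl⟩
  have hglue : 2 ∣ 2 * t' → n₂ = n₃ → n₁ = n₂ + 2 * t' → n₂ < 2 * ρ → 2 * ρ - n₂ ≤ n₂ - d + 1 →
      Valued.v (f₀ + (b - 1) / (a - 1)) ≤ Valued.v ϖ ^ (2 * ρ + 2 * t' - n₂) :=
    fun _ h23 h1 _ hb => (hf₀ h23 (by omega)).trans (pow_le_pow_right_of_le_one' hϖ1.le (by omega))
  -- the outer read of `E₁` and its four-part read, numerically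
  have hout₁ : ((Valued.v (E₁ 0) ≤ Valued.v ϖ ^ ℓ₁ ∧ Valued.v (E₁ 1) ≤ Valued.v ϖ ^ ℓ₁ ∧ Valued.v (E₁ 2) ≤ Valued.v ϖ ^ ℓ₁) ∧ ℓ₁ + ρ ≤ n₂) ↔ ℓ₁ + ρ ≤ n₂ := by
    rw [he₁0, he₁1, he₁2, hple, hple]
    exact ⟨fun h => h.2, fun h => ⟨⟨zero_le, by omega, by omega⟩, h⟩⟩
  have hread₁ : (((Valued.v (E₁ 0) ≤ Valued.v ϖ ^ ℓ₁ ∧ Valued.v (E₁ 1) ≤ Valued.v ϖ ^ ℓ₁ ∧ Valued.v (E₁ 2) ≤ Valued.v ϖ ^ ℓ₁) ∧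
        Valued.v (E₁ 1 - E₁ 0) ≤ Valued.v ϖ ^ (ℓ₁ + ρ) ∧ Valued.v (E₁ 2 - E₁ 1) ≤ Valued.v ϖ ^ (ℓ₁ + ρ + 2 * t') ∧
          (Valued.v (E₁ 2 - E₁ 1) ≤ Valued.v ϖ ^ (ℓ₁ + 2 * ρ + 2 * t') ∧ Valued.v (E₁ 2 - E₁ 0) * Valued.v ϖ ^ (2 * t') ≤ Valued.v ϖ ^ (ℓ₁ + 2 * ρ + 2 * t'))) ↔
      (ℓ₁ + 2 * ρ + 2 * t' ≤ n₁ ∧ ℓ₁ + 2 * ρ ≤ n₂)) := by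
    rw [he₁0, he₁1, he₁2, h10₁, hd₁, hk₁, ← pow_add, hple, hple, hple, hple, hple, hple]
    refine ⟨fun h => ⟨h.2.2.2.1, by omega⟩, fun h => ⟨⟨zero_le, by omega, by omega⟩, ?_, by omega, by omega, by omega⟩⟩
    rcases le_total n₁ n₂ with h' | h'
    · rw [min_eq_left h'] at hmin; omega
    · rw [min_eq_right h'] at hmin; omega
  -- `E₂`'s four-part read holds whenever `ℓ₂ + 2ρ + 2t′ ≤ n₁ + min(n₂,n₃)`, `ℓ₂ + 2ρ ≤ 2n₂` and `ρ ≤ n₃`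
  have hread₂_of : ℓ₂ + 2 * ρ + 2 * t' ≤ n₁ + min n₂ n₃ → ℓ₂ + 2 * ρ ≤ 2 * n₂ → ℓ₂ + ρ ≤ 2 * n₃ →
      ((Valued.v (E₂ 0) ≤ Valued.v ϖ ^ ℓ₂ ∧ Valued.v (E₂ 1) ≤ Valued.v ϖ ^ ℓ₂ ∧ Valued.v (E₂ 2) ≤ Valued.v ϖ ^ ℓ₂) ∧
        Valued.v (E₂ 1 - E₂ 0) ≤ Valued.v ϖ ^ (ℓ₂ + ρ) ∧ Valued.v (E₂ 2 - E₂ 1) ≤ Valued.v ϖ ^ (ℓ₂ + ρ + 2 * t') ∧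
          (Valued.v (E₂ 2 - E₂ 1) ≤ Valued.v ϖ ^ (ℓ₂ + 2 * ρ + 2 * t') ∧ Valued.v (E₂ 2 - E₂ 0) * Valued.v ϖ ^ (2 * t') ≤ Valued.v ϖ ^ (ℓ₂ + 2 * ρ + 2 * t'))) := by
    intro hA hB hC
    rw [he₂0, he₂1, he₂2, h10₂, hk₂, ← pow_add, hple, hple, hple, hple]
    refine ⟨⟨zero_le, by omega, by omega⟩, by omega, hd₂le.trans ((hple _ _).2 (by omega)), hd₂le.trans ((hple _ _).2 hA), by omega⟩
  -- case analysis on the position of `E₁`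
  by_cases hloc₁ : n₁ = n₂ + 2 * t'
  · -- `E₁` on its locus; `n₂ = n₃`
    have h23 : n₂ = n₃ := by
      rcases isoceles_of_isElementDatum hD hE with ⟨h, h'⟩ | ⟨h, h'⟩ | ⟨h, h'⟩ <;> omega
    have hloc₁' : Valued.v (E₁ 2 - E₁ 1) = Valued.v ϖ ^ (n₂ + 2 * t') := by rw [hd₁, hloc₁]
    have hvg : Valued.v ((b - 1) / (a - 1)) = Valued.v ϖ ^ (2 * t') := v_glueUnit_eq hvϖ0 (hloc₁ ▸ h₁) h₂
    have had : Valued.v (a - 1) ≤ Valued.v ϖ ^ d := by rw [h₂]; exact pow_le_pow_right_of_le_one' hϖ1.le (by omega)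
    have hbd : Valued.v (b - 1) ≤ Valued.v ϖ ^ d := by rw [h₁]; exact pow_le_pow_right_of_le_one' hϖ1.le (by omega)
    by_cases htube : 2 * ρ ≤ n₂
    · -- tube: `E₂` not cut, read TRUE
      have hcut₂ : ¬ (Valued.v (E₂ 2 - E₂ 1) = Valued.v (E₂ 2 - E₂ 0) * Valued.v ϖ ^ (2 * t') ∧ Valued.v ϖ ^ (ℓ₂ + 2 * ρ + 2 * t') < Valued.v (E₂ 2 - E₂ 1)) := by
        rintro ⟨hon, hgen⟩
        rw [hon, hk₂, ← pow_add] at hgen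
        exact absurd ((hple _ _).2 (by omega : ℓ₂ + 2 * ρ + 2 * t' ≤ 2 * n₂ + 2 * t')) (not_le.2 hgen)
      rw [finsum_stratum_G1_sep_and_eq_of_not_cut_right hD T ρ (2 * t') hρ (by omega) ℓ₁ E₁ ℓ₂ E₂ hcut₂,
        if_pos (hread₂_of (by rw [← h23, min_self]; omega) (by omega) (by omega))]
      by_cases hvac₁ : ℓ₁ + 2 * ρ ≤ n₂
      · rw [finsum_kappaCount_mul_stabiliserWeight_stratum_G1_sep_eq_of_vacuous hD h2 hE hN₀ hT ρ t' hρ ht' i f₀ hσf₀ hglue ℓ₁ n₂ E₁ hk₁ hloc₁'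
            (hout₁.2 (by omega)) hvac₁]
        have hB0 : ¬ (2 ∣ 2 * t' ∧ n₂ = n₃ ∧ n₁ = n₂ + 2 * t' ∧ n₂ < 2 * ρ ∧ 2 * ρ - n₂ ≤ n₂ - d + 1) := fun h => absurd h.2.2.2.1 (by omega)
        have hB : ¬ (2 ∣ 2 * t' ∧ n₂ = n₃ ∧ n₁ = n₂ + 2 * t' ∧ n₂ < 2 * ρ + ℓ₁ ∧ ℓ₁ + ρ ≤ n₂ ∧ ℓ₁ + 2 * ρ - n₂ ≤ n₂ - d + 1 ∧ 2 * ρ + ℓ₂ ≤ 2 * n₂) :=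
          fun h => absurd h.2.2.2.1 (by omega)
        rw [if_neg hB0, if_neg hB, add_zero, add_zero]
        exact if_congr ⟨fun h => ⟨h.1, h.2.1, h.2.2, by omega, by omega, by omega⟩, fun h => ⟨h.1, h.2.1, h.2.2.1⟩⟩ rfl rfl
      · -- cut tube
        have hA : ¬ (2 ∣ 2 * t' ∧ 2 * ρ ≤ min n₂ n₃ ∧ 2 * ρ + 2 * t' ≤ n₁ ∧ 2 * ρ + ℓ₁ ≤ n₂ ∧ 2 * ρ + 2 * t' + ℓ₁ ≤ n₁ ∧ 2 * ρ + ℓ₂ ≤ 2 * n₂) :=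
          fun h => hvac₁ (by have := h.2.2.2.1; omega)
        rw [if_neg hA, zero_add]
        have hbridge := exists_fixed_v_add_glueUnit_le_iff hσ hvσ hfix hϖ hd hd1 han hbn ha1 hb1 had hbd h₃ (by omega) hvg
          (show 2 * t' ≤ ℓ₁ + 2 * ρ + 2 * t' - n₂ by omega)
        rw [← h23, show ℓ₁ + 2 * ρ + 2 * t' - n₂ - 2 * t' = ℓ₁ + 2 * ρ - n₂ by omega] at hbridge
        have e1 : (2 * d ≤ ℓ₁ + 2 * ρ + 2 * t' - n₂ + 1) ↔ (2 * d ≤ 2 * t' + (ℓ₁ + 2 * ρ - n₂ + 1)) := by omega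
        have e2 : (2 * d + 2 * t' ≤ ℓ₁ + 2 * ρ + 2 * t' - n₂ + 1) ↔ (2 * d ≤ ℓ₁ + 2 * ρ - n₂ + 1) := by omega
        have e3 : 2 * ρ + 2 * t' - (ℓ₁ + 2 * ρ + 2 * t' - n₂ + 1) / 2 = 2 * ρ + 2 * t' / 2 - (ℓ₁ + 2 * ρ - n₂ + 1) / 2 := by omega
        by_cases hwit : ℓ₁ + 2 * ρ - n₂ ≤ n₂ - d + 1
        · have hf : Valued.v (f₀ + (b - 1) / (a - 1)) ≤ Valued.v ϖ ^ (ℓ₁ + 2 * ρ + 2 * t' - n₂) :=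
            (hf₀ h23 (by omega)).trans (pow_le_pow_right_of_le_one' hϖ1.le (by omega))
          rw [finsum_kappaCount_mul_stabiliserWeight_stratum_G1_sep_onLocus_tube_of_witness hD h2 hE hT ρ t' hρ ht' ⟨by omega, htube⟩ i ℓ₁ n₂ E₁ hk₁ hloc₁'
              (by omega) hσf₀ (by rw [hg₁]; exact hf), if_congr hout₁ rfl rfl]
          simp only [e1, e2, e3]
          by_cases hℓ : ℓ₁ + ρ ≤ n₂
          · rw [if_pos hℓ, if_pos (show 2 ∣ 2 * t' ∧ n₂ = n₃ ∧ n₁ = n₂ + 2 * t' ∧ n₂ < 2 * ρ + ℓ₁ ∧ ℓ₁ + ρ ≤ n₂ ∧ ℓ₁ + 2 * ρ - n₂ ≤ n₂ - d + 1 ∧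
                2 * ρ + ℓ₂ ≤ 2 * n₂ from ⟨hdvd, h23, hloc₁, by omega, hℓ, hwit, by omega⟩)]
          · rw [if_neg hℓ, if_neg (fun h => hℓ h.2.2.2.2.1)]
        · rw [if_neg (fun h => hwit h.2.2.2.2.2.1)]
          refine finsum_kappaCount_mul_stabiliserWeight_stratum_G1_sep_onLocus_of_no_witness hD h2 hT ρ t' hρ ht' i ℓ₁ n₂ E₁ hk₁ hloc₁' (by omega) ?_
          rw [hg₁]
          rintro ⟨f, hσf, hf⟩
          exact hwit (hbridge.1 ⟨f, hσf, hf⟩)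
    · by_cases hρm : ρ ≤ n₂
      · -- glue foot: `E₁` genuine
        have hA : ¬ (2 ∣ 2 * t' ∧ 2 * ρ ≤ min n₂ n₃ ∧ 2 * ρ + 2 * t' ≤ n₁ ∧ 2 * ρ + ℓ₁ ≤ n₂ ∧ 2 * ρ + 2 * t' + ℓ₁ ≤ n₁ ∧ 2 * ρ + ℓ₂ ≤ 2 * n₂) :=
          fun h => htube (by have := h.2.2.2.1; omega)
        rw [if_neg hA, zero_add]
        have hbridge := exists_fixed_v_add_glueUnit_le_iff hσ hvσ hfix hϖ hd hd1 han hbn ha1 hb1 had hbd h₃ (by omega) hvg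
          (show 2 * t' ≤ ℓ₁ + 2 * ρ + 2 * t' - n₂ by omega)
        rw [← h23, show ℓ₁ + 2 * ρ + 2 * t' - n₂ - 2 * t' = ℓ₁ + 2 * ρ - n₂ by omega] at hbridge
        by_cases hkeep : ℓ₂ + 2 * ρ ≤ 2 * n₂
        · -- `E₂` not cut, read TRUE
          have hcut₂ : ¬ (Valued.v (E₂ 2 - E₂ 1) = Valued.v (E₂ 2 - E₂ 0) * Valued.v ϖ ^ (2 * t') ∧
              Valued.v ϖ ^ (ℓ₂ + 2 * ρ + 2 * t') < Valued.v (E₂ 2 - E₂ 1)) := by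
            rintro ⟨hon, hgen⟩
            rw [hon, hk₂, ← pow_add] at hgen
            exact absurd ((hple _ _).2 (by omega : ℓ₂ + 2 * ρ + 2 * t' ≤ 2 * n₂ + 2 * t')) (not_le.2 hgen)
          rw [finsum_stratum_G1_sep_and_eq_of_not_cut_right hD T ρ (2 * t') hρ (by omega) ℓ₁ E₁ ℓ₂ E₂ hcut₂,
            if_pos (hread₂_of (by rw [← h23, min_self]; omega) hkeep (by omega))]
          have e1 : (2 * d ≤ ℓ₁ + 2 * ρ + 2 * t' - n₂ + 1) ↔ (2 * d ≤ 2 * t' + (ℓ₁ + 2 * ρ - n₂ + 1)) := by omega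
          have e2 : (2 * d + 2 * t' ≤ ℓ₁ + 2 * ρ + 2 * t' - n₂ + 1) ↔ (2 * d ≤ ℓ₁ + 2 * ρ - n₂ + 1) := by omega
          have e3 : 2 * ρ + 2 * t' - (ℓ₁ + 2 * ρ + 2 * t' - n₂ + 1) / 2 = 2 * ρ + 2 * t' / 2 - (ℓ₁ + 2 * ρ - n₂ + 1) / 2 := by omega
          by_cases hwit : ℓ₁ + 2 * ρ - n₂ ≤ n₂ - d + 1
          · have hf : Valued.v (f₀ + (b - 1) / (a - 1)) ≤ Valued.v ϖ ^ (ℓ₁ + 2 * ρ + 2 * t' - n₂) :=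
              (hf₀ h23 (by omega)).trans (pow_le_pow_right_of_le_one' hϖ1.le (by omega))
            rw [finsum_kappaCount_mul_stabiliserWeight_stratum_G1_sep_onLocus_foot_of_witness hD h2 hE hT ρ t' hρ ht' hloc₁ hρm (by omega) i ℓ₁ n₂ E₁ hk₁ hloc₁'
                (by omega) hσf₀ (hf.trans (pow_le_pow_right_of_le_one' hϖ1.le (by omega))) (by rw [hg₁]; exact hf), if_congr hout₁ rfl rfl,
              max_eq_right (show 2 * ρ + 2 * t' - n₂ ≤ ℓ₁ + 2 * ρ + 2 * t' - n₂ by omega)]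
            simp only [e1, e2, e3]
            by_cases hℓ : ℓ₁ + ρ ≤ n₂
            · rw [if_pos hℓ, if_pos (show 2 ∣ 2 * t' ∧ n₂ = n₃ ∧ n₁ = n₂ + 2 * t' ∧ n₂ < 2 * ρ + ℓ₁ ∧ ℓ₁ + ρ ≤ n₂ ∧ ℓ₁ + 2 * ρ - n₂ ≤ n₂ - d + 1 ∧
                  2 * ρ + ℓ₂ ≤ 2 * n₂ from ⟨hdvd, h23, hloc₁, by omega, hℓ, hwit, by omega⟩)]
            · rw [if_neg hℓ, if_neg (fun h => hℓ h.2.2.2.2.1)]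
          · rw [if_neg (fun h => hwit h.2.2.2.2.2.1)]
            refine finsum_kappaCount_mul_stabiliserWeight_stratum_G1_sep_onLocus_foot_of_no_common_witness hD h2 hE hT ρ t' hρ ht' hloc₁ hρm (by omega) i ℓ₁ n₂ E₁
              hk₁ hloc₁' (by omega) ?_
            rw [hg₁]
            rintro ⟨f, hσf, -, hf⟩
            exact hwit (hbridge.1 ⟨f, hσf, hf⟩)
        · -- `D₂`-level too deep: the cell vanishes (`E₂` off-locus ⇒ read FALSE; on-locus ⇒ genuine, disjoint balls)
          rw [if_neg (fun h => hkeep (by have := h.2.2.2.2.2.2; omega))]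
          by_cases hon : Valued.v (E₂ 2 - E₂ 1) = Valued.v (E₂ 2 - E₂ 0) * Valued.v ϖ ^ (2 * t')
          · have hloc₂' : Valued.v (E₂ 2 - E₂ 1) = Valued.v ϖ ^ (2 * n₂ + 2 * t') := by rw [hon, hk₂, ← pow_add]
            refine finsum_stratum_G1_sep_and_eq_zero_of_no_common_witness hD h2 T ρ t' hρ ht' ℓ₁ n₂ E₁ hk₁ hloc₁' ℓ₂ (2 * n₂) E₂ hk₂ hloc₂' (by omega) (by omega)
              ?_ _
            rw [hg₁, hg₂]
            exact not_exists_common_witness_rot hϖ hvg (by omega) (by omega) (by omega) _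
          · rw [finsum_stratum_G1_sep_and_eq_of_ne_right hD T ρ (2 * t') hρ (by omega) ℓ₁ E₁ ℓ₂ E₂ hon, if_neg]
            rintro ⟨-, -, -, -, hlast⟩
            rw [hk₂, ← pow_add, hple] at hlast
            omega
      · -- too shallow: empty
        rw [finsum_stratum_G1_sep_eq_zero_of_depth_lt' hD hE hT ρ (2 * t') hρ (by omega) (by omega),
          if_neg (fun h => absurd h.2.1 (by rw [← h23, min_self]; omega)), if_neg (fun h => absurd h.2.2.2.2.1 (by omega)), add_zero]
  · -- `E₁` off its locus: read, then `E₂` alone (tube: not cut, read TRUE; else empty)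
    have hne₁ : Valued.v (E₁ 2 - E₁ 1) ≠ Valued.v (E₁ 2 - E₁ 0) * Valued.v ϖ ^ (2 * t') := by
      rw [hd₁, hk₁, ← pow_add, Ne, hpeq]; exact hloc₁
    have hB : ¬ (2 ∣ 2 * t' ∧ n₂ = n₃ ∧ n₁ = n₂ + 2 * t' ∧ n₂ < 2 * ρ + ℓ₁ ∧ ℓ₁ + ρ ≤ n₂ ∧ ℓ₁ + 2 * ρ - n₂ ≤ n₂ - d + 1 ∧ 2 * ρ + ℓ₂ ≤ 2 * n₂) :=
      fun h => hloc₁ h.2.2.1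
    have hB0 : ¬ (2 ∣ 2 * t' ∧ n₂ = n₃ ∧ n₁ = n₂ + 2 * t' ∧ n₂ < 2 * ρ ∧ 2 * ρ - n₂ ≤ n₂ - d + 1) := fun h => hloc₁ h.2.2.1
    rw [if_neg hB, add_zero, finsum_stratum_G1_sep_and_eq_of_ne_left hD T ρ (2 * t') hρ (by omega) ℓ₁ E₁ hne₁ ℓ₂ E₂, if_congr hread₁ rfl rfl]
    by_cases htube : 2 * ρ + 2 * t' ≤ n₁ ∧ 2 * ρ ≤ n₂
    · have h3ρ : 2 * ρ ≤ n₃ := by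
        rcases le_total n₁ n₂ with h' | h'
        · rw [min_eq_left h'] at hmin; omega
        · rw [min_eq_right h'] at hmin; omega
      have hcut₂ : ¬ (Valued.v (E₂ 2 - E₂ 1) = Valued.v (E₂ 2 - E₂ 0) * Valued.v ϖ ^ (2 * t') ∧ Valued.v ϖ ^ (ℓ₂ + 2 * ρ + 2 * t') < Valued.v (E₂ 2 - E₂ 1)) := by
        rintro ⟨hon, hgen⟩
        rw [hon, hk₂, ← pow_add] at hgen
        exact absurd ((hple _ _).2 (by omega : ℓ₂ + 2 * ρ + 2 * t' ≤ 2 * n₂ + 2 * t')) (not_le.2 hgen)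
      have hminle : ℓ₂ ≤ min n₂ n₃ + ℓ₁ := by
        rcases le_total n₂ n₃ with h' | h'
        · rw [min_eq_left h']; omega
        · rw [min_eq_right h']; omega
      by_cases hr : ℓ₁ + 2 * ρ + 2 * t' ≤ n₁ ∧ ℓ₁ + 2 * ρ ≤ n₂
      · rw [if_pos hr, finsum_kappaCount_mul_stabiliserWeight_stratum_G1_sep_latticeInLevel_of_not_cut hD h2 hE hN₀ hT ρ (2 * t') hρ (by omega) i f₀ hσf₀ hglue
            ℓ₂ E₂ hcut₂, if_pos (hread₂_of (by omega) (by omega) (by omega)), if_neg hB0, add_zero]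
        exact if_congr ⟨fun h => ⟨h.1, h.2.1, h.2.2, by omega, by omega, by omega⟩, fun h => ⟨h.1, h.2.1, h.2.2.1⟩⟩ rfl rfl
      · have hA : ¬ (2 ∣ 2 * t' ∧ 2 * ρ ≤ min n₂ n₃ ∧ 2 * ρ + 2 * t' ≤ n₁ ∧ 2 * ρ + ℓ₁ ≤ n₂ ∧ 2 * ρ + 2 * t' + ℓ₁ ≤ n₁ ∧ 2 * ρ + ℓ₂ ≤ 2 * n₂) :=
          fun h => hr ⟨by have := h.2.2.2.2.1; omega, by have := h.2.2.2.1; omega⟩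
        rw [if_neg hr, if_neg hA]
    · have hA : ¬ (2 ∣ 2 * t' ∧ 2 * ρ ≤ min n₂ n₃ ∧ 2 * ρ + 2 * t' ≤ n₁ ∧ 2 * ρ + ℓ₁ ≤ n₂ ∧ 2 * ρ + 2 * t' + ℓ₁ ≤ n₁ ∧ 2 * ρ + ℓ₂ ≤ 2 * n₂) :=
        fun h => htube ⟨h.2.2.1, (le_min_iff.1 h.2.1).1⟩
      rw [finsum_stratum_G1_sep_eq_zero_of_offFoot' hD hE hT ρ t' hρ ht' hloc₁ htube, if_neg hA]
      exact ite_self _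

end Rot

/-! ## §3  The G3 cell in box-sum currency -/

section G3

variable {K : Type} [Field K] [Valued K ℤᵐ⁰] [CompleteSpace K] [Fintype 𝓀[K]] {σ : K →+* K} {ϖ : K} {d t : ℕ} {α β : K} {N₀ n₁ n₂ n₃ : ℕ}
  {T : GL (Fin 3) K}

open Classical in
/-- **GLUED CELL `G3(ρ,s) = (2ρ+s, 2ρ+s, 2ρ)` IN BOX-SUM CURRENCY** (fence `2 ≤ d`, `2d ≤ nᵢ + 1`, `ℓ₁ ≤ 2`, `ℓ₂ ≤ nᵢ`;
`εG 2 := (ω(f₂), ω·ω(f₂)ω(1+f₂), ω·ω(1+f₂))`, `f₂` the trunk's third glue witness with `hf₂ : n₂ = n₁ → n₂ ≤ n₃ → |f₂ + (βα⁻¹−1)∕(α⁻¹−1)| ≤ |ϖ|^{n₃−d+1}` verbatim):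
`hG3` of `LevLabelledBoxSum` token for token — §2 on the rotated datum `(α⁻¹, βα⁻¹; n₃, n₂, n₁)` through ★ T3 `…_G3_sep_two_of_G1`, the rotated letters of record being
`α·(0, βα⁻¹ − α⁻¹, 1 − α⁻¹) = (0, β−1, α−1)` and its entrywise square. [cite: Kottwitz1986BaseChangeUnits, §1 pp. 240–241] [cite: LanglandsShelstad1987, §3]
[cite: Serre1979, Ch. V §3 Prop. 5, Cor. 3] [cite: Rogawski1990, §4.9 Prop. 4.9.1 (a)(b) p. 55] -/
theorem cell_G3 (hD : IsRamifiedQuadraticDatum σ ϖ d t) (h2 : Valued.v (2 : K) < 1) (hE : IsElementDatum σ ϖ N₀ α β n₁ n₂ n₃) (hN₀ : d ≤ N₀)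
    (hT : (T : Matrix (Fin 3) (Fin 3) K) = Matrix.diagonal ![α, β, 1]) (hd2 : 2 ≤ d) (hfence : 2 * d ≤ n₁ + 1 ∧ 2 * d ≤ n₂ + 1 ∧ 2 * d ≤ n₃ + 1)
    {ℓ₁ ℓ₂ : ℕ} (hℓ₁ : ℓ₁ ≤ 2) (hℓ₂ : ℓ₂ ≤ n₁ + ℓ₁ ∧ ℓ₂ ≤ n₂ + ℓ₁ ∧ ℓ₂ ≤ n₃ + ℓ₁)
    (hℓ₂e : ℓ₂ ≤ n₁ + n₁ % 2 ∧ ℓ₂ ≤ n₂ + n₂ % 2 ∧ ℓ₂ ≤ n₃ + n₃ % 2) (ρ s : ℕ) (hρ : 1 ≤ ρ) (hs : 1 ≤ s) (i : Fin 3) (f₂ : K) (hσf₂ : σ f₂ = f₂)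
    (hf₂ : n₂ = n₁ → n₂ ≤ n₃ → Valued.v (f₂ + (β * α⁻¹ - 1) / (α⁻¹ - 1)) ≤ Valued.v ϖ ^ (n₃ - d + 1)) :
    ∑ᶠ M ∈ {M | M ∈ stratum σ ϖ T ![2 * ρ + s, 2 * ρ + s, 2 * ρ] ∧
        (LatticeInLevel ϖ ℓ₁ (Matrix.diagonal ![α - 1, β - 1, 0]) M ∧ LatticeInLevel ϖ ℓ₂ (Matrix.diagonal ![(α - 1) * (α - 1), (β - 1) * (β - 1), 0]) M)},
        (kappaCount σ ϖ 0 i M : ℚ) * stabiliserWeight σ M =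
      (if 2 ∣ s ∧ 2 * ρ ≤ min n₁ n₂ ∧ 2 * ρ + s ≤ n₃ ∧ 2 * ρ + ℓ₁ ≤ n₂ ∧ 2 * ρ + s + ℓ₁ ≤ n₃ ∧ 2 * ρ + ℓ₂ ≤ 2 * n₂ then
          (![0, 0, (normSign σ (-1 : K) : ℚ) * (Fintype.card 𝓀[K] : ℚ) ^ (2 * ρ + s / 2 - 1) *
              ((if 2 * d ≤ s then (Fintype.card 𝓀[K] : ℚ) - 1 else 0) - (if s + 2 = 2 * d then 1 else 0))] : Fin 3 → ℚ) i
        else 0) +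
      (if 2 ∣ s ∧ n₁ = n₂ ∧ n₃ = n₁ + s ∧ n₁ < 2 * ρ + ℓ₁ ∧ ℓ₁ + ρ ≤ n₁ ∧ ℓ₁ + 2 * ρ - n₁ ≤ n₁ - d + 1 ∧ 2 * ρ + ℓ₂ ≤ 2 * n₁ then
          (![if 2 * d ≤ ℓ₁ + 2 * ρ - n₁ + 1 then (normSign σ f₂ : ℚ) else 0,
             if 2 * d ≤ ℓ₁ + 2 * ρ - n₁ + 1 then (normSign σ (-1 : K) : ℚ) * normSign σ f₂ * normSign σ (1 + f₂) else 0,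
             if 2 * d ≤ s + (ℓ₁ + 2 * ρ - n₁ + 1) then (normSign σ (-1 : K) : ℚ) * normSign σ (1 + f₂) else 0] : Fin 3 → ℚ) i *
            (Fintype.card 𝓀[K] : ℚ) ^ (2 * ρ + s / 2 - (ℓ₁ + 2 * ρ - n₁ + 1) / 2)
        else 0) := by
  classical
  have hvσ : ∀ c, Valued.v (σ c) = Valued.v c := hD.2.1
  have hαn : α * σ α = 1 := hE.1
  have hα0 : α ≠ 0 := fun h => by rw [h, zero_mul] at hαn; exact zero_ne_one hαn
  have hvα : Valued.v α = 1 := UnitaryThreeFourFrame.v_eq_one_of_mul_map_eq_one hvσ hαn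
  -- the G1 statement to be rotated
  let Hyp : K → K → ℕ → ℕ → ℕ → (Fin 3 → K) → (Fin 3 → K) → Prop := fun a' b' n₁' n₂' n₃' e₁' e₂' =>
    ∃ u : K, Valued.v u = 1 ∧ e₁' = ![0, u * (b' - a'), u * (1 - a')] ∧ e₂' = ![0, (u * (b' - a')) * (u * (b' - a')), (u * (1 - a')) * (u * (1 - a'))] ∧
      (2 * d ≤ n₁' + 1 ∧ 2 * d ≤ n₂' + 1 ∧ 2 * d ≤ n₃' + 1) ∧ (ℓ₂ ≤ n₁' + ℓ₁ ∧ ℓ₂ ≤ n₂' + ℓ₁ ∧ ℓ₂ ≤ n₃' + ℓ₁) ∧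
      (ℓ₂ ≤ n₁' + n₁' % 2 ∧ ℓ₂ ≤ n₂' + n₂' % 2 ∧ ℓ₂ ≤ n₃' + n₃' % 2) ∧
      (n₂' = n₃' → n₂' ≤ n₁' → Valued.v (f₂ + (b' - 1) / (a' - 1)) ≤ Valued.v ϖ ^ (n₁' - d + 1))
  let F : K → K → ℕ → ℕ → ℕ → (Fin 3 → K) → (Fin 3 → K) → Fin 3 → ℚ := fun _ _ n₁' n₂' n₃' _ _ j =>
    (if 2 ∣ s ∧ 2 * ρ ≤ min n₂' n₃' ∧ 2 * ρ + s ≤ n₁' ∧ 2 * ρ + ℓ₁ ≤ n₂' ∧ 2 * ρ + s + ℓ₁ ≤ n₁' ∧ 2 * ρ + ℓ₂ ≤ 2 * n₂' then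
        (![(normSign σ (-1 : K) : ℚ) * (Fintype.card 𝓀[K] : ℚ) ^ (2 * ρ + s / 2 - 1) *
            ((if 2 * d ≤ s then (Fintype.card 𝓀[K] : ℚ) - 1 else 0) - (if s + 2 = 2 * d then 1 else 0)), 0, 0] : Fin 3 → ℚ) j
      else 0) +
    (if 2 ∣ s ∧ n₂' = n₃' ∧ n₁' = n₂' + s ∧ n₂' < 2 * ρ + ℓ₁ ∧ ℓ₁ + ρ ≤ n₂' ∧ ℓ₁ + 2 * ρ - n₂' ≤ n₂' - d + 1 ∧ 2 * ρ + ℓ₂ ≤ 2 * n₂' then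
        (![if 2 * d ≤ s + (ℓ₁ + 2 * ρ - n₂' + 1) then (normSign σ (-1 : K) : ℚ) * normSign σ (1 + f₂) else 0,
           if 2 * d ≤ ℓ₁ + 2 * ρ - n₂' + 1 then (normSign σ (-1 : K) : ℚ) * normSign σ f₂ * normSign σ (1 + f₂) else 0,
           if 2 * d ≤ ℓ₁ + 2 * ρ - n₂' + 1 then (normSign σ f₂ : ℚ) else 0] : Fin 3 → ℚ) j *
          (Fintype.card 𝓀[K] : ℚ) ^ (2 * ρ + s / 2 - (ℓ₁ + 2 * ρ - n₂' + 1) / 2)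
      else 0)
  have hG1 : ∀ {a' b' : K} {n₁' n₂' n₃' : ℕ} (T' : GL (Fin 3) K) (e₁' e₂' : Fin 3 → K), IsElementDatum σ ϖ N₀ a' b' n₁' n₂' n₃' →
      (T' : Matrix (Fin 3) (Fin 3) K) = Matrix.diagonal ![a', b', 1] → Hyp a' b' n₁' n₂' n₃' e₁' e₂' →
        ∀ j : Fin 3, ∑ᶠ M ∈ {M | M ∈ stratum σ ϖ T' ![2 * ρ, 2 * ρ + s, 2 * ρ + s] ∧
            (LatticeInLevel ϖ ℓ₁ (Matrix.diagonal e₁') M ∧ LatticeInLevel ϖ ℓ₂ (Matrix.diagonal e₂') M)},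
          (kappaCount σ ϖ 0 j M : ℚ) * stabiliserWeight σ M = F a' b' n₁' n₂' n₃' e₁' e₂' j := by
    intro a' b' n₁' n₂' n₃' T' e₁' e₂' hE' hT' hHyp j
    obtain ⟨u, hu, rfl, rfl, hfence', hℓ₂', hℓ₂e', hf'⟩ := hHyp
    exact cell_G1_rot hD h2 hE' hN₀ hT' hd2 hfence' hℓ₁ hℓ₂' hℓ₂e' ρ s hρ hs j hu f₂ hσf₂ hf'
  have hHyp : Hyp α⁻¹ (β * α⁻¹) n₃ n₂ n₁ ![(![α - 1, β - 1, 0] : Fin 3 → K) 2, (![α - 1, β - 1, 0] : Fin 3 → K) 1, (![α - 1, β - 1, 0] : Fin 3 → K) 0]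
      ![(![(α - 1) * (α - 1), (β - 1) * (β - 1), 0] : Fin 3 → K) 2, (![(α - 1) * (α - 1), (β - 1) * (β - 1), 0] : Fin 3 → K) 1,
        (![(α - 1) * (α - 1), (β - 1) * (β - 1), 0] : Fin 3 → K) 0] := by
    refine ⟨α, hvα, ?_, ?_, ⟨hfence.2.2, hfence.2.1, hfence.1⟩, ⟨hℓ₂.2.2, hℓ₂.2.1, hℓ₂.1⟩, ⟨hℓ₂e.2.2, hℓ₂e.2.1, hℓ₂e.1⟩, hf₂⟩
    · have e1 : α * (β * α⁻¹ - α⁻¹) = β - 1 := by field_simp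
      have e2 : α * (1 - α⁻¹) = α - 1 := by field_simp
      simp only [Matrix.cons_val_zero, Matrix.cons_val_one, Matrix.cons_val_two, Matrix.tail_cons, Matrix.head_cons, e1, e2]
    · have e1 : α * (β * α⁻¹ - α⁻¹) = β - 1 := by field_simp
      have e2 : α * (1 - α⁻¹) = α - 1 := by field_simp
      simp only [Matrix.cons_val_zero, Matrix.cons_val_one, Matrix.cons_val_two, Matrix.tail_cons, Matrix.head_cons, e1, e2]
  rw [finsum_kappaCount_mul_stabiliserWeight_stratum_G3_sep_two_of_G1 hvσ hE hT ρ s ℓ₁ ℓ₂ Hyp F hG1 _ _ hHyp i]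
  simp only [F]
  by_cases h12 : n₁ = n₂
  · subst h12
    fin_cases i <;> simp [Equiv.swap_apply_of_ne_of_ne, Equiv.swap_apply_left, Equiv.swap_apply_right]
  · have hB : ¬ (2 ∣ s ∧ n₁ = n₂ ∧ n₃ = n₁ + s ∧ n₁ < 2 * ρ + ℓ₁ ∧ ℓ₁ + ρ ≤ n₁ ∧ ℓ₁ + 2 * ρ - n₁ ≤ n₁ - d + 1 ∧ 2 * ρ + ℓ₂ ≤ 2 * n₁) :=
      fun h => h12 h.2.1
    have hB' : ¬ (2 ∣ s ∧ n₂ = n₁ ∧ n₃ = n₂ + s ∧ n₂ < 2 * ρ + ℓ₁ ∧ ℓ₁ + ρ ≤ n₂ ∧ ℓ₁ + 2 * ρ - n₂ ≤ n₂ - d + 1 ∧ 2 * ρ + ℓ₂ ≤ 2 * n₂) :=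
      fun h => h12 h.2.1.symm
    rw [if_neg hB, if_neg hB', add_zero, add_zero]
    fin_cases i <;> simp [Equiv.swap_apply_of_ne_of_ne, Equiv.swap_apply_left, Equiv.swap_apply_right, min_comm n₁ n₂]

end G3

end Summit.HodgeConjecture.HodgeConjecture.Cruxes.H413.F0P3cDyRamLevLabelledCellsGluedThree

end
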